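import Summits.BirchSwinnertonDyer.BirchSwinnertonDyer.Theorems.CMKolyvaginAtInertTwoConjugationTypeAtTwo
import Summits.BirchSwinnertonDyer.Rank1Residual.GaloisImage.KolyvaginPrimeTorsionCount
import Literature.NumberTheory.EllipticCurves.HeegnerPointsKolyvaginEulerSystem
import Literature.NumberTheory.EllipticCurves.GoodReductionUnramifiedProofs
import Literature.NumberTheory.EllipticCurves.LFunctionPrimeCoeff
import Literature.NumberTheory.GaloisRepresentations.IntegralGaloisActionProofs

/-!
# Route `GenusKolyvaginAtTwo`, crux `GenusPrimitiveSupplyAtTwo` (stmt-BirchSwinnertonDyer-22136):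
# for `Δ_E > 0` complex conjugation — hence every Gross–Kolyvagin Frobenius at `2` — FIXES `E[2]`

Seat `bsd-line-gk2-p3` g5 (cell `bsd-f1-sign2`). Summit-side THEOREM-ONLY file (no definition, no named
fact, no `sorry`), `--supports stmt-BirchSwinnertonDyer-22136` (helper).

WHY. The line's Kolyvagin primes in Gross's form (`IsKolyvaginPrime … 2 ℓ`, condition (3.2)
`FrobEqFrobInfty W K 2 ℓ`: an arithmetic Frobenius at `ℓ` acts on `E[2]` as a complex conjugation `c₀`)
behave in two opposite ways according to the sign of the minimal discriminant: for `Δ_E < 0`, `c₀` is a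
TRANSPOSITION on `E[2] ∖ 0` (sibling route, `KolyvaginEigenTwo.exists_twoTorsion_smul_ne_of_Δ_neg`); for
`Δ_E > 0` it is the IDENTITY — proved here. Consequently at a Gross prime `ℓ` of a `Δ_E > 0` curve the
Frobenius fixes `E[2]` pointwise (`ℓ` splits completely in `ℚ(E[2])`, all three `2`-division abscissae are
`ℓ`-adically rational, and both genus twists `E^{(ℓ*)}`, `E^{(ℓ*d_K)}` acquire Tamagawa number `c_ℓ = 4`): the
kernel-checked input `r_ℓ = 3` of the seat's BSD-side ledger of the open kernel U (crux workfile
`Cruxes/GenusPrimitiveSupplyAtTwo/Lines/genus-supply-u-ledger.md`, verdict (R1): on `Δ_E > 0` the certificate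
`P(n) ∉ 2E(K[n])` at Gross primes is BSD-inconsistent once `Ш(E)[2] ≠ 0`; the route's KILL CRITERION «the supply
needs `Δ_E < 0` ⇒ the habitat shrinks»).

* `isRoot_twoTorsionPolynomial_smul` — `Gal(ℚ̄/ℚ)` permutes the roots in `ℚ̄` of the `2`-division cubic.
* `isRoot_twoTorsionPolynomial_of_two_smul_eq_zero` — the abscissa of a point of order `2` is such a root.
* `smul_eq_of_isRoot_twoTorsionPolynomial_of_Δ_pos` — **`Δ > 0` ⇒ a complex conjugation fixes every root**:
  if `c₀` moved a root `x`, then `c₀` swaps `x, x' = c₀x` and fixes the third root `x''`, so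
  `δ = 16(x−x')(x−x'')(x'−x'')` has `c₀δ = −δ`; under `ι : ℚ̄ → ℂ` with `ι ∘ c₀ = conj ∘ ι` the number `ιδ` is
  purely imaginary, so `16Δ = δ²` (Mathlib `Cubic.discr_eq_prod_three_roots`, `twoTorsionPolynomial_discr`)
  is `≤ 0` — contradiction.
* `twoTorsion_smul_eq_of_Δ_pos` — **`Δ > 0` ⇒ `c₀ • v = v` for every `v ∈ E(ℚ̄)[2]`.**
* `frob_smul_twoTorsion_eq_of_frobEqFrobInfty_of_Δ_pos` — **Gross's (3.2) at `p = 2` with `Δ > 0`: an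
  arithmetic Frobenius at `ℓ` fixes `E[2]` pointwise**; `exists_twoTorsion_frob_smul_ne_of_frobEqFrobInfty_of_Δ_neg`
  — with `Δ < 0` it moves some `2`-torsion point (from the sibling's lemma).

HONEST FRAMING. Elementary Galois theory of the `2`-division cubic; nothing about `Ш`, no item closed; it
fixes in the kernel the dichotomy on which the pen's pending restatement (Gross-form primes ⇒ habitat
`W.Δ < 0`) turns. BSD is not proved by any of this.
References: [SilvermanAEC2009] III.1 (2-division cubic, `16Δ = disc`), [GrossLMS1991] §3 (3.2),
[McCallumLMS1991] §3 (the `p` odd analogue: both eigenvalues occur).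
-/

set_option autoImplicit false
set_option linter.dupNamespace false

noncomputable section

open scoped Classical

namespace Summit.BirchSwinnertonDyer.BirchSwinnertonDyer.Theorems.GenusKolySign

open Polynomial WeierstrassCurve Field
open Literature.NumberTheory.EllipticCurves Literature.NumberTheory.GaloisRepresentations
open Literature.NumberTheory.EllipticCurves.Rank1Residual
open Summit.BirchSwinnertonDyer.BirchSwinnertonDyer.Theorems.KolyvaginEigenTwo
  (exists_point_two_smul_eq_zero_of_isRoot exists_twoTorsion_smul_ne_of_Δ_neg)

variable (W : WeierstrassCurve ℚ) [W.IsElliptic]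

/-! ### §1 The Galois group permutes the roots of the `2`-division cubic; abscissae of `2`-torsion points are roots -/

omit [W.IsElliptic] in
/-- `Gal(ℚ̄/ℚ)` permutes the roots in `ℚ̄` of the (rational) `2`-division cubic `4x³ + b₂x² + 2b₄x + b₆`.
[folklore] -/
theorem isRoot_twoTorsionPolynomial_smul (σ : absoluteGaloisGroup ℚ) {e : AlgebraicClosure ℚ}
    (he : (Cubic.map (algebraMap ℚ (AlgebraicClosure ℚ)) W.twoTorsionPolynomial).toPoly.IsRoot e) :
    (Cubic.map (algebraMap ℚ (AlgebraicClosure ℚ)) W.twoTorsionPolynomial).toPoly.IsRoot (σ • e) := by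
  rw [Cubic.map_toPoly, IsRoot.def, eval_map, ← aeval_def] at he ⊢
  have hσ : σ • e = (absoluteGaloisGroup.toAlgEquiv ℚ σ).toAlgHom e := rfl
  rw [hσ, aeval_algHom_apply, he, map_zero]

omit [W.IsElliptic] in
/-- A complex conjugation of `ℚ̄` is an involution: `c₀ • (c₀ • e) = e`. [folklore] -/
theorem smul_smul_eq_of_isComplexConjugation {c₀ : absoluteGaloisGroup ℚ}
    (hc₀ : IsComplexConjugation (Rat.castHom ℝ) c₀) (e : AlgebraicClosure ℚ) : c₀ • (c₀ • e) = e := by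
  obtain ⟨ι, -, hι⟩ := isComplexConjugation_iff.mp hc₀
  apply ι.injective
  rw [hι, hι, starRingEnd_self_apply]

/-- **The abscissa of a point of order `2` is a root of the `2`-division cubic**: if `2 • (x, y) = 0` on
`E/ℚ̄` then `(x,y) = −(x,y) = (x, −y − a₁x − a₃)`, so `2y + a₁x + a₃ = 0`, and substituting in the Weierstrass
equation gives `4x³ + b₂x² + 2b₄x + b₆ = (2y + a₁x + a₃)² − 4·(y² + a₁xy + a₃y − x³ − a₂x² − a₄x − a₆) = 0`.
[cite: SilvermanAEC2009, III.2.3 (d)] -/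
theorem isRoot_twoTorsionPolynomial_of_two_smul_eq_zero {x y : AlgebraicClosure ℚ}
    {h : (W.baseChange (AlgebraicClosure ℚ)).toAffine.Nonsingular x y}
    (h2 : (2 : ℤ) • (Affine.Point.some x y h : geomPoints W) = 0) :
    (Cubic.map (algebraMap ℚ (AlgebraicClosure ℚ)) W.twoTorsionPolynomial).toPoly.IsRoot x ∧
      2 * y + (W.baseChange (AlgebraicClosure ℚ)).a₁ * x + (W.baseChange (AlgebraicClosure ℚ)).a₃ = 0 := by
  haveI : (W.baseChange (AlgebraicClosure ℚ)).IsElliptic := by rw [baseChange]; infer_instance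
  set W' := W.baseChange (AlgebraicClosure ℚ) with hW'
  set P : geomPoints W := Affine.Point.some x y h with hP
  -- `P = -P`
  have hneg : P = -P := by
    rw [two_zsmul] at h2
    exact eq_neg_of_add_eq_zero_left h2
  have hy : y = -y - W'.a₁ * x - W'.a₃ := by
    have h' : (Affine.Point.some x y h : W'.toAffine.Point) = -(Affine.Point.some x y h) := hneg
    rw [Affine.Point.neg_some] at h'
    injection h' with _ hy'
    try exact hy'
  have hlin : 2 * y + W'.a₁ * x + W'.a₃ = 0 := by linear_combination hy
  refine ⟨?_, hlin⟩
  have heq' : W'.toAffine.Equation x y := Affine.equation_iff_nonsingular.mpr h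
  have heq : y ^ 2 + W'.a₁ * x * y + W'.a₃ * y = x ^ 3 + W'.a₂ * x ^ 2 + W'.a₄ * x + W'.a₆ :=
    (Affine.equation_iff x y).mp heq'
  -- the cubic over `ℚ̄` is the base-changed one
  have hcub : Cubic.map (algebraMap ℚ (AlgebraicClosure ℚ)) W.twoTorsionPolynomial = W'.twoTorsionPolynomial := by
    simp [hW', baseChange, twoTorsionPolynomial, Cubic.map, map_b₂, map_b₄, map_b₆, map_ofNat]
  rw [hcub]
  simp only [twoTorsionPolynomial, Cubic.toPoly, IsRoot.def, eval_add, eval_mul, eval_C, eval_pow, eval_X]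
  have hb₂ : W'.b₂ = W'.a₁ ^ 2 + 4 * W'.a₂ := rfl
  have hb₄ : W'.b₄ = 2 * W'.a₄ + W'.a₁ * W'.a₃ := rfl
  have hb₆ : W'.b₆ = W'.a₃ ^ 2 + 4 * W'.a₆ := rfl
  rw [hb₂, hb₄, hb₆]
  linear_combination (2 * y + W'.a₁ * x + W'.a₃) * hlin - 4 * heq

/-! ### §2 `Δ > 0`: complex conjugation fixes every root, hence every `2`-torsion point -/

omit [W.IsElliptic] in
/-- **`Δ > 0` ⇒ a complex conjugation fixes every root of the `2`-division cubic.** If `c₀` moved a root `x`,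
then (the roots being three and distinct, `16Δ = disc ≠ 0`) `c₀` swaps `x` and `x' := c₀x` and fixes the
remaining root `x''`, so `δ := 16(x − x')(x − x'')(x' − x'')` satisfies `c₀δ = −δ`; under an embedding
`ι : ℚ̄ → ℂ` with `ι(c₀z) = conj(ιz)` the number `ιδ` is purely imaginary, whence `16Δ = δ²` (as complex
numbers, `Cubic.discr_eq_prod_three_roots`) has real part `−(Im ιδ)² ≤ 0`, contradicting `Δ > 0`.
[cite: SilvermanAEC2009, III.1] -/
theorem smul_eq_of_isRoot_twoTorsionPolynomial_of_Δ_pos (hΔ : 0 < W.Δ) {c₀ : absoluteGaloisGroup ℚ}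
    (hc₀ : IsComplexConjugation (Rat.castHom ℝ) c₀) {x : AlgebraicClosure ℚ}
    (hx : (Cubic.map (algebraMap ℚ (AlgebraicClosure ℚ)) W.twoTorsionPolynomial).toPoly.IsRoot x) :
    c₀ • x = x := by
  by_contra hne
  obtain ⟨ι, -, hι⟩ := isComplexConjugation_iff.mp hc₀
  set C := Cubic.map (algebraMap ℚ (AlgebraicClosure ℚ)) W.twoTorsionPolynomial with hC
  have ha : W.twoTorsionPolynomial.a ≠ 0 := by change (4 : ℚ) ≠ 0; norm_num
  have hsplit : (W.twoTorsionPolynomial.toPoly.map (algebraMap ℚ (AlgebraicClosure ℚ))).Splits :=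
    IsAlgClosed.splits _
  obtain ⟨e₁, e₂, e₃, h3⟩ := (Cubic.splits_iff_roots_eq_three ha).mp hsplit
  have ha' : C.a ≠ 0 := by
    change algebraMap ℚ (AlgebraicClosure ℚ) W.twoTorsionPolynomial.a ≠ 0
    exact (_root_.map_ne_zero _).mpr ha
  have hne0 : C.toPoly ≠ 0 := Cubic.ne_zero_of_a_ne_zero ha'
  -- the roots are distinct
  have hdisc0 : W.twoTorsionPolynomial.discr ≠ 0 := by
    rw [twoTorsionPolynomial_discr]; positivity
  have hnodup : C.roots.Nodup := (Cubic.discr_ne_zero_iff_roots_nodup ha hsplit).mp hdisc0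
  have hcard : Multiset.card C.roots = 3 := by rw [h3]; rfl
  -- `x`, `x' = c₀ x` are two distinct roots; `x''` is the third
  set x' := c₀ • x with hx'
  have hxm : x ∈ C.roots := (mem_roots hne0).mpr hx
  have hx'm : x' ∈ C.roots := (mem_roots hne0).mpr (isRoot_twoTorsionPolynomial_smul W c₀ hx)
  have hx'x : x' ≠ x := hne
  have hcx' : c₀ • x' = x := smul_smul_eq_of_isComplexConjugation hc₀ x
  have h1 : C.roots = x ::ₘ C.roots.erase x := (Multiset.cons_erase hxm).symm
  have hx'm1 : x' ∈ C.roots.erase x := (Multiset.mem_erase_of_ne hx'x).mpr hx'm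
  have h2 : C.roots.erase x = x' ::ₘ (C.roots.erase x).erase x' := (Multiset.cons_erase hx'm1).symm
  have hcard1 : Multiset.card ((C.roots.erase x).erase x') = 1 := by
    have := Multiset.card_erase_of_mem hx'm1
    rw [Multiset.card_erase_of_mem hxm, hcard] at this
    simpa using this
  obtain ⟨x'', hx''⟩ := Multiset.card_eq_one.mp hcard1
  have h3' : C.roots = {x, x', x''} := by
    rw [h1, h2, hx'']; rfl
  have hnd : x ≠ x' ∧ x ≠ x'' ∧ x' ≠ x'' := by
    rw [h3'] at hnodup
    simp only [Multiset.insert_eq_cons, Multiset.nodup_cons, Multiset.mem_cons, Multiset.mem_singleton,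
      not_or] at hnodup
    exact ⟨hnodup.1.1, hnodup.1.2, hnodup.2.1⟩
  have hx''m : x'' ∈ C.roots := by rw [h3']; simp
  -- `c₀` fixes the third root
  have hcx'' : c₀ • x'' = x'' := by
    have hm : c₀ • x'' ∈ C.roots :=
      (mem_roots hne0).mpr (isRoot_twoTorsionPolynomial_smul W c₀ ((mem_roots hne0).mp hx''m))
    rw [h3'] at hm
    simp only [Multiset.insert_eq_cons, Multiset.mem_cons, Multiset.mem_singleton] at hm
    rcases hm with hm | hm | hm
    · -- `c₀ x'' = x = c₀ x'` forces `x'' = x'`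
      exfalso; apply hnd.2.2
      have := congrArg (fun z ↦ c₀ • z) hm
      simp only [smul_smul_eq_of_isComplexConjugation hc₀] at this
      -- `this : x'' = c₀ • x = x'`
      exact (this.trans hx'.symm).symm
    · exfalso; apply hnd.2.1
      have := congrArg (fun z ↦ c₀ • z) hm
      simp only [smul_smul_eq_of_isComplexConjugation hc₀] at this
      -- `this : x'' = c₀ • x' = x`
      exact (this.trans hcx').symm
    · exact hm
  -- the discriminant as a square
  have hdisc := Cubic.discr_eq_prod_three_roots ha h3'
  rw [twoTorsionPolynomial_discr] at hdisc
  have ha4 : W.twoTorsionPolynomial.a = 4 := rfl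
  rw [ha4] at hdisc
  set δ : AlgebraicClosure ℚ := algebraMap ℚ (AlgebraicClosure ℚ) 4 * algebraMap ℚ (AlgebraicClosure ℚ) 4 *
    (x - x') * (x - x'') * (x' - x'') with hδ
  -- `c₀ δ = -δ`
  have hcδ : c₀ • δ = -δ := by
    have hσ : ∀ z : AlgebraicClosure ℚ, c₀ • z = absoluteGaloisGroup.toAlgEquiv ℚ c₀ z := fun _ ↦ rfl
    have e1 : absoluteGaloisGroup.toAlgEquiv ℚ c₀ x = x' := by rw [← hσ]
    have e2 : absoluteGaloisGroup.toAlgEquiv ℚ c₀ x' = x := by rw [← hσ, hcx']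
    have e3 : absoluteGaloisGroup.toAlgEquiv ℚ c₀ x'' = x'' := by rw [← hσ, hcx'']
    rw [hσ, hδ]
    simp only [map_mul, map_sub, e1, e2, e3, map_ofNat]
    ring
  -- under `ι`, `ι δ` is purely imaginary while `(ι δ)² = 16 Δ > 0`
  have hconj : starRingEnd ℂ (ι δ) = -ι δ := by rw [← hι, hcδ, map_neg]
  have hre : (ι δ).re = 0 := by
    have h := congrArg Complex.re hconj
    simp only [Complex.conj_re, Complex.neg_re] at h
    linarith
  have hCx : ((16 * W.Δ : ℚ) : ℂ) = (ι δ) ^ 2 := by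
    have := congrArg ι hdisc
    rw [map_pow, eq_ratCast, map_ratCast] at this
    exact this
  have hreal : (((16 * W.Δ : ℚ) : ℝ) : ℂ).re = ((ι δ) ^ 2).re := by
    rw [Complex.ofReal_ratCast, hCx]
  rw [Complex.ofReal_re, sq, Complex.mul_re, hre] at hreal
  have hle : ((16 * W.Δ : ℚ) : ℝ) ≤ 0 := by
    rw [hreal]; nlinarith [mul_self_nonneg (ι δ).im]
  have : (16 * W.Δ : ℚ) ≤ 0 := by exact_mod_cast hle
  linarith

/-- **`Δ > 0` ⇒ complex conjugation acts TRIVIALLY on `E[2]`**: for `W/ℚ` elliptic with `Δ(W) > 0` and any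
complex conjugation `c₀ ∈ Gal(ℚ̄/ℚ)`, `c₀ • v = v` for every `v ∈ E(ℚ̄)[2]` (all three `2`-division abscissae
are real). Converse companion of the sibling route's `KolyvaginEigenTwo.exists_twoTorsion_smul_ne_of_Δ_neg`
(`Δ < 0` ⇒ some `v` is moved). [cite: SilvermanAEC2009, III.1] -/
theorem twoTorsion_smul_eq_of_Δ_pos (hΔ : 0 < W.Δ) {c₀ : absoluteGaloisGroup ℚ}
    (hc₀ : IsComplexConjugation (Rat.castHom ℝ) c₀) (v : geomTorsion W 2) : c₀ • v = v := by
  apply Subtype.ext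
  have hv2 : (2 : ℤ) • (v : geomPoints W) = 0 := (mem_geomTorsion_iff W 2 (v : geomPoints W)).mp v.2
  change c₀ • (v : geomPoints W) = v
  rcases hP : (v : geomPoints W) with _ | ⟨x, y, h⟩
  · exact smul_zero c₀
  · rw [hP] at hv2
    obtain ⟨hroot, hlin⟩ := isRoot_twoTorsionPolynomial_of_two_smul_eq_zero W hv2
    have hx : c₀ • x = x := smul_eq_of_isRoot_twoTorsionPolynomial_of_Δ_pos W hΔ hc₀ hroot
    set W' := W.baseChange (AlgebraicClosure ℚ) with hW'
    have hσ : ∀ z : AlgebraicClosure ℚ, c₀ • z = absoluteGaloisGroup.toAlgEquiv ℚ c₀ z := fun _ ↦ rfl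
    have ha₁ : W'.a₁ = ((W.a₁ : ℚ) : AlgebraicClosure ℚ) := eq_ratCast (algebraMap ℚ (AlgebraicClosure ℚ)) _
    have ha₃ : W'.a₃ = ((W.a₃ : ℚ) : AlgebraicClosure ℚ) := eq_ratCast (algebraMap ℚ (AlgebraicClosure ℚ)) _
    have hyx : y = -(W'.a₁ * x + W'.a₃) / 2 := by linear_combination hlin / 2
    have hy : c₀ • y = y := by
      rw [hσ] at hx ⊢
      conv_lhs => rw [hyx, ha₁, ha₃]
      conv_rhs => rw [hyx, ha₁, ha₃]
      simp only [map_div₀, map_neg, map_add, map_mul, map_ratCast, map_ofNat, hx]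
    set P : geomPoints W := Affine.Point.some x y h with hPdef
    have hmap : c₀ • P = Affine.Point.map ((absoluteGaloisGroup.toAlgEquiv ℚ c₀).toAlgHom) P := rfl
    rw [hmap, hPdef, Affine.Point.map_some]
    rw [hσ] at hx hy
    congr 1

/-! ### §3 Gross's (3.2) at `p = 2`: the Frobenius at a Kolyvagin prime on `E[2]`, by the sign of `Δ` -/

/-- **At a Gross–Kolyvagin prime of a `Δ > 0` curve the Frobenius fixes `E[2]` pointwise.** If
`FrobEqFrobInfty W K 2 ℓ` (Gross 1991 (3.2): some arithmetic Frobenius `h` at a prime above `ℓ` acts on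
`E[2]` and on `K` as a complex conjugation) and `Δ(W) > 0`, then that Frobenius satisfies `h • v = v` for all
`v ∈ E(ℚ̄)[2]` — `ℓ` splits completely in `ℚ(E[2])`, the `2`-division cubic has three roots mod `ℓ`, and the
genus twists `E^{(ℓ*)}`, `E^{(ℓ*d_K)}` have Tamagawa number `4` at `ℓ` (Tate, type I₀*). This is the input
`r_ℓ = 3` of verdict (R1) of the seat's U-ledger. [cite: GrossLMS1991, §3 (3.2)] [cite: SilvermanAEC2009, III.1] -/
theorem frob_smul_twoTorsion_eq_of_frobEqFrobInfty_of_Δ_pos (hΔ : 0 < W.Δ) {K : Type}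
    [Field K] [NumberField K] {ℓ : ℕ} (hℓ : FrobEqFrobInfty W K 2 ℓ) :
    ∃ (v : IsDedekindDomain.HeightOneSpectrum (NumberField.RingOfIntegers ℚ))
      (𝔓 : Ideal (absIntegers (NumberField.RingOfIntegers ℚ) ℚ)) (h : absoluteGaloisGroup ℚ),
      ((ℓ : NumberField.RingOfIntegers ℚ) ∈ v.asIdeal ∧ 𝔓 ∈ v.primesAbove ∧
        IsArithFrobAt (NumberField.RingOfIntegers ℚ) h 𝔓) ∧
      ∀ P : geomTorsion W 2, h • P = P := by
  obtain ⟨v, 𝔓, h, c₀, hv, h𝔓, hfr, hc₀, hP, -⟩ := hℓ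
  refine ⟨v, 𝔓, h, ⟨hv, h𝔓, hfr⟩, fun P ↦ ?_⟩
  rw [hP P]
  exact twoTorsion_smul_eq_of_Δ_pos W hΔ hc₀ P

/-- **At a Gross–Kolyvagin prime of a `Δ < 0` curve the Frobenius MOVES some `2`-torsion point**
(transposition type; the sibling route's `exists_twoTorsion_smul_ne_of_Δ_neg` transported along Gross's (3.2)).
[cite: GrossLMS1991, §3 (3.2)] [cite: SilvermanAEC2009, III.1] -/
theorem exists_twoTorsion_frob_smul_ne_of_frobEqFrobInfty_of_Δ_neg (hΔ : W.Δ < 0) {K : Type}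
    [Field K] [NumberField K] {ℓ : ℕ} (hℓ : FrobEqFrobInfty W K 2 ℓ) :
    ∃ (v : IsDedekindDomain.HeightOneSpectrum (NumberField.RingOfIntegers ℚ))
      (𝔓 : Ideal (absIntegers (NumberField.RingOfIntegers ℚ) ℚ)) (h : absoluteGaloisGroup ℚ),
      ((ℓ : NumberField.RingOfIntegers ℚ) ∈ v.asIdeal ∧ 𝔓 ∈ v.primesAbove ∧
        IsArithFrobAt (NumberField.RingOfIntegers ℚ) h 𝔓) ∧
      ∃ P : geomTorsion W 2, h • P ≠ P := by
  obtain ⟨v, 𝔓, h, c₀, hv, h𝔓, hfr, hc₀, hP, -⟩ := hℓ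
  obtain ⟨P, hPne⟩ := exists_twoTorsion_smul_ne_of_Δ_neg W hΔ hc₀
  exact ⟨v, 𝔓, h, ⟨hv, h𝔓, hfr⟩, P, by rw [hP P]; exact hPne⟩

/-! ### §4 (APPEND 1, same seat) -/

open IsDedekindDomain NumberField

/-! ### §4 Reduction: at a Gross prime of a `Δ > 0` curve all the `2`-torsion is rational mod `ℓ` -/

/-- **`#Ẽ(𝔽_ℓ)[2] = 4` at a Gross–Kolyvagin prime of a `Δ > 0` curve.** `W/ℚ` globally minimal with
`Δ(W) > 0`, `ℓ` an odd prime of good reduction with Gross's (3.2) `FrobEqFrobInfty W K 2 ℓ`, `v` the place of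
`ℚ` at `ℓ`: the reduction `Ẽ_v` has FOUR `k_v`-rational `2`-torsion points, i.e. the `2`-division cubic
splits completely mod `ℓ` (`r_ℓ = 3`). Reduction identifies `Ẽ_v(k_v)[2]` with the fixed points on `E[2]` of
an arithmetic Frobenius `σ₀` at some `𝔓₀ ∣ v` (Silverman VII.3.1(b)); moving `𝔓₀` to the prime `𝔓` of (3.2)
by `g ∈ Gal(ℚ̄/ℚ)` and comparing `gσ₀g⁻¹` with the Frobenius `h` of (3.2) up to inertia (trivial on `E[2]`,
VII.4.1(a)), §3 gives that `σ₀` fixes `E[2]` pointwise, and `#E[2] = 4` (III.6.4(b)). Consequence for the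
line (Tate's algorithm, type I₀*): both genus twists `E^{(ℓ*)}`, `E^{(ℓ*d_K)}` have `c_ℓ = 4` — the input
`r_ℓ = 3` of verdict (R1) of the U-ledger. [cite: SilvermanAEC2009, Prop. VII.3.1(b), Prop. VII.4.1(a), Cor. III.6.4(b)]
[cite: GrossLMS1991, §3 (3.2)] -/
theorem natCard_twoTorsion_reductionAt_eq_four_of_frobEqFrobInfty_of_Δ_pos [W.IsGloballyMinimal]
    (hΔ : 0 < W.Δ) {K : Type} [Field K] [NumberField K] {ℓ : ℕ} [Fact ℓ.Prime] (hℓ2 : ℓ ≠ 2)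
    (hgoodℓ : W.HasGoodReductionAtPrime ℓ) (hℓ : FrobEqFrobInfty W K 2 ℓ)
    {v : IsDedekindDomain.HeightOneSpectrum (NumberField.RingOfIntegers ℚ)}
    (hv : (ℓ : NumberField.RingOfIntegers ℚ) ∈ v.asIdeal) :
    Nat.card (AddSubgroup.torsionBy (W.reductionAt v).toAffine.Point ((2 : ℕ) : ℤ)) = 4 := by
  haveI : Fact (Nat.Prime 2) := ⟨Nat.prime_two⟩
  have hℓp : ℓ.Prime := Fact.out
  obtain ⟨v', 𝔓, h, ⟨hv', h𝔓, hfr⟩, hfix⟩ := frob_smul_twoTorsion_eq_of_frobEqFrobInfty_of_Δ_pos W hΔ hℓ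
  -- the place above `ℓ` is unique
  have hvℓ : (Rat.HeightOneSpectrum.primesEquiv v : ℕ) = ℓ := primesEquiv_eq_of_natCast_mem hℓp hv
  have hvv : v' = v := by
    have h1 : (Rat.HeightOneSpectrum.primesEquiv v' : ℕ) = ℓ := primesEquiv_eq_of_natCast_mem hℓp hv'
    exact Rat.HeightOneSpectrum.primesEquiv.injective (Subtype.ext (h1.trans hvℓ.symm))
  rw [hvv] at h𝔓
  -- a Frobenius `σ₀` whose fixed points on `E[2]` count `Ẽ_v(k_v)[2]`
  obtain ⟨σ₀, 𝔓₀, h𝔓₀, hσ₀, hcount⟩ :=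
    Summit.BirchSwinnertonDyer.Rank1Residual.GaloisImage.FrobShape.exists_frobenius_natCard_fixed_eq
      W 2 ℓ hℓ2 hgoodℓ hv
  have hc1 := hcount 1
  rw [pow_one] at hc1
  rw [← hc1]
  -- move `σ₀` to `𝔓` and compare with `h` up to inertia
  obtain ⟨g, hg⟩ := IsDedekindDomain.HeightOneSpectrum.exists_smul_eq_of_mem_primesAbove_holds h𝔓₀ h𝔓
  have hσ₁ : IsArithFrobAt (NumberField.RingOfIntegers ℚ) (g * σ₀ * g⁻¹) 𝔓 := hg ▸ hσ₀.conj g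
  have hI := hfr.mul_inv_mem_inertia hσ₁
  have hgood : W.HasGoodReductionAt v := (hasGoodReductionAtPrime_primesEquiv_iff_holds W v ℓ hvℓ).mp hgoodℓ
  have h2v : (2 : NumberField.RingOfIntegers ℚ) ∉ v.asIdeal := fun h2 ↦
    hℓ2 (hvℓ.symm.trans (primesEquiv_eq_of_natCast_mem Nat.prime_two (by exact_mod_cast h2)))
  have h2v' : ((((2 : ℕ) : ℤ)) : NumberField.RingOfIntegers ℚ) ∉ v.asIdeal := by
    rw [Int.cast_natCast]; exact_mod_cast h2v
  have hσσ₁ : ∀ P : geomTorsion W ((2 : ℕ) : ℤ), h • P = (g * σ₀ * g⁻¹) • P := fun P ↦ by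
    have h' := W.smul_geomTorsion_eq_of_mem_inertia hgood h2v' h𝔓 hI ((g * σ₀ * g⁻¹) • P)
    rwa [mul_smul, inv_smul_smul] at h'
  -- so `σ₀` fixes `E[2]` pointwise
  have hall : ∀ P : geomTorsion W ((2 : ℕ) : ℤ), σ₀ • P = P := fun P ↦ by
    have h' : (g * σ₀ * g⁻¹) • (g • P) = g • P := by rw [← hσσ₁]; exact hfix (g • P)
    rw [mul_smul, mul_smul, inv_smul_smul] at h'
    exact smul_left_cancel g h'
  have hfixAll : Nat.card {P : geomTorsion W ((2 : ℕ) : ℤ) // σ₀ • P = P} =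
      Nat.card (geomTorsion W ((2 : ℕ) : ℤ)) := Nat.card_congr (Equiv.subtypeUnivEquiv hall)
  rw [hfixAll]
  have hE : Nat.card (geomTorsion W ((2 : ℕ) : ℤ)) = 2 ^ 2 :=
    card_torsionPoints_eq_sq_holds W (AlgebraicClosure ℚ) (by norm_num)
  rw [hE]; norm_num

end Summit.BirchSwinnertonDyer.BirchSwinnertonDyer.Theorems.GenusKolySign

end
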